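import Summits.Ventures.CertifiedArithmetic.Expansions.EstimateLastBit
import Mathlib.Tactic.Linarith
import Mathlib.Tactic.Positivity
import Mathlib.Tactic.Ring
import Mathlib.Tactic.NormNum

/-!
# APPROXIMATE under round-to-even errs by less than three quarters of `u·2^s`

HONEST FRAMING. New work of this programme (Ventures), not a published result: the statements
below are ours; Shewchuk's paper supplies only the objects (`estimate` = APPROXIMATE /
`predicates.c`'s `estimate()`, nonoverlapping expansions `IsExpansion 1`, the gap relation
`Below`, `RoundoffBelow`). Machine-checked below; the numerical evidence that preceded the proof
is recorded at the end of this docstring.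

THE RESULT. Let `l` be a nonoverlapping expansion of floats of `F(p, emin)` (`p ≥ 1`, smallest
component first, zeros allowed, gradual underflow included), all components `< 2^s` in magnitude,
and `Q = estimate fl l`. If `fl` is a round-to-nearest whose roundoff always lies 2-below its
result (`RoundoffBelow 2 fl` — round-to-even is one, `roundoffBelow_two_roundTiesEven`), then

  `|Q − Σ l| < (3/4)·u·2^s`,  `u = 2^-p`

(`abs_estimate_sub_sum_lt_three_quarters`, `…_roundTiesEven`, `…_unitRoundoff`). The constant is
the right one: `exists_isRoundNearest_three_quarters_le` exhibits a round-to-nearest of `F(2, 0)`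
(ties away from zero at the two midpoints it meets) for which the nonoverlapping expansion
`[1, 4, 8]` gives `Q = 16`, `Σ = 13`, `|Q − Σ| = 3 = (3/4)·u·2^4` — so without the tie rule the
strict three quarters fail (indeed no constant below `1` serves every tie rule: ties toward
zero on `[1, 2, 4, …, 2^n]` in `F(1, 0)` give `(1 − 2^-n)·u·2^s`); and under round-to-even itself
the supremum IS `3/4`: the companion file `EstimateThreeQuartersLowerBound` of this series
reaches `(3/4 − 2^-p)·u·2^s` on strongly nonoverlapping and `(3/4 − 2^(-p-2))·u·2^s` on
nonoverlapping expansions, for every `p ≥ 3`.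

MECHANISM — the last-bit theorem does the work (`EstimateLastBit`: under `RoundoffBelow 2` the
running error `E = Q − Σ` satisfies `2|E| < 2^g` for the least nonzero bit `2^g` of `Q`). Induct
along the fold; let `a = M·2^v` (`M` odd) be the next component, so every earlier component and
the running word satisfy `|x| < 2^v`, `|Q| ≤ 2^v`, and `t = Q + a`, `|t| ≤ 2^s`, new error
`δ + E` with `|δ| ≤ (1/2)·u·2^s`.
* `v ≤ s − 2`: induction at scale `v` gives `|E| < (3/4)·u·2^v ≤ (3/16)·u·2^s`; total `< 11/16`.
* `v = s − 1` and `|t| ≤ 2^(s−1)`: `|δ| ≤ (1/4)·u·2^s`, `|E| < (3/8)·u·2^s`; total `< 5/8`.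
* `v = s − 1` and `|t| > 2^(s−1)`, `Q = m·2^g` (`m` odd): if `2^g ≥ u·2^s` then `t` is a multiple
  of `u·2^s = 2^(s−p)` of magnitude `≤ 2^s`, hence a float, `δ = 0`, total `< 3/8`; if
  `2^g ≤ u·2^s/2` then the last-bit theorem gives `|E| < 2^g/2 ≤ (1/4)·u·2^s` and the total is
  `< 1/2 + 1/4 = 3/4`. Only this last branch reaches `3/4`, and it is the shape of the extremal
  families (a tie in the top binade over a word that is odd at half the top ulp).

EVIDENCE BEFORE PROOF (exhaustive enumeration, integers scaled so the first component is odd, all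
sign patterns; seat folder `work/rne/check_hinfN.c`): over every nonoverlapping list with
`n ≤ 7/8` components below `2^12 … 2^15`, round-to-even gives `max |Q − Σ|/(u·2^s) = 0.6665 (p = 1),
0.7139 (p = 2), 0.7332 (p = 3), 0.7383 (p = 4), 0.7422 (p = 5)` — never `≥ 3/4`, creeping up to
it; with every tie adversarial the same lists reach `15/16` already at `n = 5`.

References: J. R. Shewchuk, Discrete Comput. Geom. 18 (1997) 305–363: §2.1 (nonoverlapping,
round-to-even Cor. 9), §2.7 APPROXIMATE ("errs by less than one ulp"), `predicates.c`
`estimate()` [Shewchuk1997].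
-/

namespace Summit.Ventures.CertifiedArithmetic.Expansions

open Literature.ComputerArithmetic.JeannerodRump2018
open Literature.ComputerArithmetic.BoldoJeannerodMelquiondMuller2023 hiding twoSum twoSum_fst
  isFloat_twoSum
open Literature.ComputerArithmetic.JoldesMullerPopescu2017 (isFloat_two_zpow abs_fl_le_of_abs_le)
open Literature.ComputerArithmetic.Shewchuk1997

variable {p : ℕ} {emin : ℤ} {fl : ℚ → ℚ}

/-- **Exact step.** A multiple of `2^emin` and of `2^(s-p)` of magnitude at most `2^s` is a float
of `F(p, emin)`, so a round-to-nearest returns it unchanged. -/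
theorem fl_eq_self_of_onGrid_of_abs_le (hp : 1 ≤ p) (hfl : IsRoundNearest p emin fl) {t : ℚ}
    {s : ℤ} (hte : OnGrid emin t) (hts : OnGrid (s - p) t) (ht : |t| ≤ (2 : ℚ) ^ s) :
    fl t = t := by
  have h2ne : (2 : ℚ) ≠ 0 := by norm_num
  apply fl_eq_self hfl
  -- the coarser of the two grids `2^emin`, `2^(s-p)` carries a significand `|N| ≤ 2^p`
  have key : ∀ k : ℤ, emin ≤ k → s - p ≤ k → OnGrid k t → IsFloat p emin t := by
    intro k hk hsk ⟨N, hN⟩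
    have h2k : (0 : ℚ) < (2 : ℚ) ^ k := zpow_pos (by norm_num) _
    have hNp : |N| ≤ 2 ^ p := by
      have h1 : |(N : ℚ)| * (2 : ℚ) ^ k ≤ (2 : ℚ) ^ s := by
        rw [hN, abs_mul, abs_of_pos h2k] at ht; exact ht
      have h2 : (2 : ℚ) ^ s ≤ (2 : ℚ) ^ p * (2 : ℚ) ^ k := by
        rw [← zpow_natCast, ← zpow_add₀ h2ne]
        exact zpow_le_zpow_right₀ (by norm_num) (by omega)
      have h3 : |(N : ℚ)| ≤ (2 : ℚ) ^ p := le_of_mul_le_mul_right (h1.trans h2) h2k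
      rw [← Int.cast_abs] at h3
      exact_mod_cast h3
    rw [hN]; exact isFloat_of_abs_le hp hNp hk
  rcases le_or_gt emin (s - p) with h | h
  · exact key (s - p) h le_rfl hts
  · exact key emin le_rfl h.le hte

/-- **APPROXIMATE UNDER A 2-BELOW ROUND-TO-NEAREST (E.G. ROUND-TO-EVEN) ERRS BY LESS THAN
`(3/4)·u·2^s`** on every nonoverlapping expansion of floats with components `< 2^s` (`p ≥ 1`, any
length, zeros and gradual underflow allowed; `u·2^s = 2^(s-p)`). -/
theorem abs_estimate_sub_sum_lt_three_quarters (hp : 1 ≤ p) (hfl : IsRoundNearest p emin fl)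
    (hfl2 : RoundoffBelow 2 fl) :
    ∀ {l : List ℚ}, (∀ x ∈ l, IsFloat p emin x) → IsExpansion 1 l →
      ∀ {s : ℤ}, (∀ x ∈ l, |x| < (2 : ℚ) ^ s) →
        |estimate fl l - l.sum| < 3 / 4 * (2 : ℚ) ^ (s - p) := by
  have h2ne : (2 : ℚ) ≠ 0 := by norm_num
  have hflj : RoundoffBelow ((2 : ℚ) ^ (1 : ℕ)) fl := by simpa using hfl2
  intro l
  induction l using List.reverseRecOn with
  | nil =>
    intro _ _ s _
    rw [show estimate fl [] = 0 from rfl, List.sum_nil, sub_zero, abs_zero]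
    exact mul_pos (by norm_num) (zpow_pos (by norm_num) _)
  | append_singleton l a ih =>
    intro hF hE s hs
    have hFl : ∀ x ∈ l, IsFloat p emin x := fun x hx => hF x (by simp [hx])
    have hFa : IsFloat p emin a := hF a (by simp)
    have hEl : IsExpansion 1 l := (List.pairwise_append.mp hE).1
    have hbelow : ∀ x ∈ l, Below 1 x a := fun x hx =>
      (List.pairwise_append.mp hE).2.2 x hx a (by simp)
    have hsl : ∀ x ∈ l, |x| < (2 : ℚ) ^ s := fun x hx => hs x (by simp [hx])
    have has : |a| < (2 : ℚ) ^ s := hs a (by simp)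
    have hpos : (0 : ℚ) < (2 : ℚ) ^ (s - p) := zpow_pos (by norm_num) _
    rw [List.sum_append, List.sum_singleton]
    by_cases hl : l = []
    · subst hl
      rw [show estimate fl ([] ++ [a]) = a from rfl, List.sum_nil, zero_add, sub_self, abs_zero]
      exact mul_pos (by norm_num) hpos
    have hstep : estimate fl (l ++ [a]) = fl (estimate fl l + a) := by
      obtain ⟨e, es, rfl⟩ := List.exists_cons_of_ne_nil hl
      simp [estimate, List.foldl_append]
    rw [hstep]
    obtain ⟨hQF, hQB, hQM⟩ := estimate_lastBit_invariant hp hfl (j := 1) hp hflj hFl hEl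
    set Q := estimate fl l with hQdef
    by_cases ha0 : a = 0
    · rw [ha0, add_zero, add_zero, fl_eq_self hfl hQF]
      exact ih hFl hEl hsl
    obtain ⟨M, v, hMo, -, -, hav⟩ := exists_odd_mul_two_zpow hFa ha0
    have haG : OnGrid v a := ⟨M, hav⟩
    -- every earlier component, hence the running word, lies below the quantum `2^v` of `a`
    have hlv : ∀ x ∈ l, |x| < (2 : ℚ) ^ v := fun x hx => by
      obtain ⟨s', hs', hxs'⟩ := hbelow x hx
      rw [one_mul] at hxs'
      rw [hav] at hs'
      exact lt_of_lt_of_le hxs' (zpow_le_zpow_right₀ (by norm_num) (OnGrid.le_of_odd hMo hs'))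
    have hE₁ : |Q - l.sum| < 3 / 4 * (2 : ℚ) ^ (v - p) := ih hFl hEl hlv
    obtain ⟨hQv, -⟩ := hQM v hlv
    have hva : (2 : ℚ) ^ v ≤ |a| := haG.two_zpow_le_abs ha0
    have hvs : v < s := by
      by_contra hle
      rw [not_lt] at hle
      have : (2 : ℚ) ^ s ≤ (2 : ℚ) ^ v := zpow_le_zpow_right₀ (by norm_num) hle
      linarith
    have hle_a : |a| + (2 : ℚ) ^ v ≤ (2 : ℚ) ^ s :=
      haG.abs.add_two_zpow_le (OnGrid.two_zpow hvs.le) has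
    set t := Q + a with htdef
    have ht_le : |t| ≤ (2 : ℚ) ^ s := by
      calc |t| = |Q + a| := by rw [htdef]
        _ ≤ |Q| + |a| := abs_add_le _ _
        _ ≤ (2 : ℚ) ^ s := by linarith
    have htG : OnGrid emin t := by
      rw [htdef]; exact (OnGrid.of_isFloat hQF).add (OnGrid.of_isFloat hFa)
    have hδ : 2 * |fl t - t| ≤ (2 : ℚ) ^ (s - p) := two_mul_abs_fl_sub_le_of_onGrid hp hfl htG ht_le
    have hsplit : fl t - (l.sum + a) = fl t - t + (Q - l.sum) := by rw [htdef]; ring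
    rw [hsplit]
    have htri : |fl t - t + (Q - l.sum)| ≤ |fl t - t| + |Q - l.sum| := abs_add_le _ _
    rcases le_or_gt v (s - 2) with hv2 | hv2
    · -- `v ≤ s - 2`: the old error is at most `(3/16)·2^(s-p)`
      have h4 : (2 : ℚ) ^ (v - p) * 4 ≤ (2 : ℚ) ^ (s - p) := by
        rw [show (4 : ℚ) = (2 : ℚ) ^ (2 : ℤ) by norm_num, ← zpow_add₀ h2ne]
        exact zpow_le_zpow_right₀ (by norm_num) (by omega)
      linarith
    · -- `v = s - 1`
      have hv1 : v = s - 1 := by omega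
      have h2v : (2 : ℚ) ^ (v - p) * 2 = (2 : ℚ) ^ (s - p) := by
        rw [← zpow_add_one₀ h2ne]; congr 1; omega
      rcases le_or_gt |t| ((2 : ℚ) ^ v) with htv | htv
      · -- `|t| ≤ 2^(s-1)`: the roundoff is at most `(1/4)·2^(s-p)`
        have hδ' : 2 * |fl t - t| ≤ (2 : ℚ) ^ (v - p) :=
          two_mul_abs_fl_sub_le_of_onGrid hp hfl htG htv
        linarith
      · -- `|t| > 2^(s-1)`: read the least nonzero bit `2^g` of `Q` off the last-bit theorem
        obtain ⟨g, hgQ, hgE⟩ := hQB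
        rw [pow_one] at hgE
        rcases le_or_gt (s - p) g with hg | hg
        · -- `2^g ≥ 2^(s-p)`: `t` is a float, the step is exact
          have hts : OnGrid (s - p) t := by
            rw [htdef]; exact (hgQ.mono hg).add (haG.mono (by omega))
          rw [fl_eq_self_of_onGrid_of_abs_le hp hfl htG hts ht_le, sub_self, zero_add]
          linarith
        · -- `2^g ≤ 2^(s-p)/2`: `|E| < 2^g/2 ≤ 2^(s-p)/4`
          have hg2 : (2 : ℚ) ^ g * 2 ≤ (2 : ℚ) ^ (s - p) := by
            rw [← zpow_add_one₀ h2ne]; exact zpow_le_zpow_right₀ (by norm_num) (by omega)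
          linarith

/-- **ROUND-TO-EVEN: `|estimate l − Σ l| < (3/4)·2^(s-p)`** on every nonoverlapping expansion of
floats of `F(p, emin)` with components `< 2^s` (`p ≥ 1`). -/
theorem abs_estimate_sub_sum_lt_three_quarters_roundTiesEven (hp : 1 ≤ p) {l : List ℚ}
    (hF : ∀ x ∈ l, IsFloat p emin x) (hE : IsExpansion 1 l) {s : ℤ}
    (hs : ∀ x ∈ l, |x| < (2 : ℚ) ^ s) :
    |estimate (roundTiesEven p emin) l - l.sum| < 3 / 4 * (2 : ℚ) ^ (s - p) :=
  abs_estimate_sub_sum_lt_three_quarters hp (isRoundNearest_roundTiesEven hp)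
    (roundoffBelow_two_roundTiesEven p emin) hF hE hs

/-- The same bound written with the unit roundoff `u = 2^-p`: `|estimate l − Σ l| < (3/4)·u·2^s`. -/
theorem abs_estimate_sub_sum_lt_three_quarters_unitRoundoff (hp : 1 ≤ p)
    (hfl : IsRoundNearest p emin fl) (hfl2 : RoundoffBelow 2 fl) {l : List ℚ}
    (hF : ∀ x ∈ l, IsFloat p emin x) (hE : IsExpansion 1 l) {s : ℤ}
    (hs : ∀ x ∈ l, |x| < (2 : ℚ) ^ s) :
    |estimate fl l - l.sum| < 3 / 4 * unitRoundoff p * (2 : ℚ) ^ s := by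
  have h := abs_estimate_sub_sum_lt_three_quarters hp hfl hfl2 hF hE hs
  have hu : unitRoundoff p * (2 : ℚ) ^ s = (2 : ℚ) ^ (s - p) := by
    unfold unitRoundoff
    rw [zpow_sub₀ (by norm_num : (2 : ℚ) ≠ 0), zpow_natCast]; ring
  rw [mul_assoc, hu]; exact h

/-! ## The tie rule is needed for the strict three quarters -/

/-- **WITHOUT THE TIE RULE THE STRICT THREE QUARTERS FAIL.** The rounding of `F(2, 0)` that takes
the midpoints `5 ↦ 6` and `14 ↦ 16` (away from zero; the floats around are `4, 6` and `12, 16`)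
and agrees with round-to-even elsewhere is a round-to-nearest for which the nonoverlapping
expansion `[1, 4, 8]` (components `< 2^4`) has `estimate = 16`, `Σ = 13`:
`|estimate − Σ| = 3 = (3/4)·2^(4-2)`. -/
theorem exists_isRoundNearest_three_quarters_le :
    ∃ fl : ℚ → ℚ, IsRoundNearest 2 0 fl ∧
      (∀ x ∈ [(1 : ℚ), 4, 8], IsFloat 2 0 x) ∧ IsExpansion 1 [(1 : ℚ), 4, 8] ∧
      (∀ x ∈ [(1 : ℚ), 4, 8], |x| < (2 : ℚ) ^ (4 : ℤ)) ∧
      estimate fl [1, 4, 8] = 16 ∧ [(1 : ℚ), 4, 8].sum = 13 ∧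
      ¬ |estimate fl [1, 4, 8] - [(1 : ℚ), 4, 8].sum| < 3 / 4 * (2 : ℚ) ^ ((4 : ℤ) - (2 : ℕ)) := by
  set fl : ℚ → ℚ := fun t => if t = 5 then 6 else if t = 14 then 16 else roundTiesEven 2 0 t
    with hfl
  have h5 : fl 5 = 6 := by simp [hfl]
  have h14 : fl 14 = 16 := by norm_num [hfl]
  have hQ : estimate fl [1, 4, 8] = 16 := by
    rw [show estimate fl [1, 4, 8] = fl (fl (1 + 4) + 8) from rfl, show (1 : ℚ) + 4 = 5 by norm_num,
      h5, show (6 : ℚ) + 8 = 14 by norm_num, h14]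
  -- an odd integer is never `N·2^n` with `n ≥ 1`, and for `n = 0` the significand bound decides
  have hodd : ∀ (c : ℤ), Odd c → 4 ≤ c → ∀ (N : ℤ) (n : ℕ), |N| < 2 ^ 2 → c - N * 2 ^ n ≠ 0 := by
    intro c hc hc4 N n hN
    norm_num at hN
    have := abs_lt.mp hN
    rcases n with _ | n
    · simp only [pow_zero, mul_one]; omega
    · rw [pow_succ, ← mul_assoc]
      generalize N * 2 ^ n = K
      obtain ⟨k, rfl⟩ := hc
      omega
  have hRN : IsRoundNearest 2 0 fl := by
    intro t
    by_cases ht5 : t = 5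
    · subst ht5
      rw [h5]
      refine ⟨⟨3, 1, by norm_num, by norm_num, by norm_num⟩, fun f hf => ?_⟩
      obtain ⟨N, e, hN, he, rfl⟩ := hf
      obtain ⟨n, rfl⟩ := Int.eq_ofNat_of_zero_le he
      rw [zpow_natCast, show |(5 : ℚ) - 6| = 1 by norm_num]
      have h1 : (((1 : ℤ)) : ℚ) ≤ (((|(5 : ℤ) - N * 2 ^ n|) : ℤ) : ℚ) := by
        exact_mod_cast Int.one_le_abs (hodd 5 (by decide) (by norm_num) N n hN)
      rw [Int.cast_abs] at h1
      push_cast at h1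
      exact h1
    by_cases ht14 : t = 14
    · subst ht14
      rw [h14]
      refine ⟨⟨1, 4, by norm_num, by norm_num, by norm_num⟩, fun f hf => ?_⟩
      obtain ⟨N, e, hN, he, rfl⟩ := hf
      obtain ⟨n, rfl⟩ := Int.eq_ofNat_of_zero_le he
      rw [zpow_natCast, show |(14 : ℚ) - 16| = 2 by norm_num]
      -- `14 − N·2^n` is a nonzero integer, and even unless `n = 0` (where it is `≥ 11`)
      have h2 : (2 : ℤ) ≤ |(14 : ℤ) - N * 2 ^ n| := by
        rcases n with _ | n
        · norm_num at hN
          have := abs_lt.mp hN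
          simp only [pow_zero, mul_one]
          rw [le_abs]; left; omega
        · have h7 := hodd 7 (by decide) (by norm_num) N n hN
          rw [pow_succ, ← mul_assoc, show (14 : ℤ) - N * 2 ^ n * 2 = 2 * (7 - N * 2 ^ n) by ring,
            abs_mul, show |(2 : ℤ)| = 2 by norm_num]
          have := Int.one_le_abs h7
          linarith
      have h2' : (((2 : ℤ)) : ℚ) ≤ (((|(14 : ℤ) - N * 2 ^ n|) : ℤ) : ℚ) := by exact_mod_cast h2
      rw [Int.cast_abs] at h2'
      push_cast at h2'
      exact h2'
    · rw [show fl t = roundTiesEven 2 0 t by simp [hfl, ht5, ht14]]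
      exact isRoundNearest_roundTiesEven (p := 2) (emin := 0) (by norm_num) t
  refine ⟨fl, hRN, ?_, ?_, ?_, hQ, by norm_num, ?_⟩
  · intro x hx
    simp only [List.mem_cons, List.mem_nil_iff, or_false] at hx
    rcases hx with rfl | rfl | rfl
    · exact ⟨1, 0, by norm_num, le_rfl, by norm_num⟩
    · exact ⟨1, 2, by norm_num, by norm_num, by norm_num⟩
    · exact ⟨1, 3, by norm_num, by norm_num, by norm_num⟩
  · refine List.Pairwise.cons ?_ (List.pairwise_pair.mpr ⟨3, ⟨1, by norm_num⟩, by norm_num⟩)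
    intro y hy
    simp only [List.mem_cons, List.mem_nil_iff, or_false] at hy
    rcases hy with rfl | rfl
    · exact ⟨2, ⟨1, by norm_num⟩, by norm_num⟩
    · exact ⟨3, ⟨1, by norm_num⟩, by norm_num⟩
  · intro x hx
    simp only [List.mem_cons, List.mem_nil_iff, or_false] at hx
    rcases hx with rfl | rfl | rfl <;> norm_num
  · rw [hQ]; norm_num

end Summit.Ventures.CertifiedArithmetic.Expansions
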